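import Summits.NavierStokesRegularity.NavierStokesRegularity.Theorems.ExtremiserTransienceZoomCompactness
import Summits.NavierStokesRegularity.NavierStokesRegularity.Theorems.ExtremiserTransienceZoomPlateauVolume
import Summits.NavierStokesRegularity.NavierStokesRegularity.Theorems.ExtremiserTransiencePlateauPersistenceSlice
import HarnessLib

/-!
# Route `ExtremiserTransience`, items `RegularisedSliceTransfer` (stmt-NavierStokesRegularity-28318) and
# `NearExtremalTransiencePerFlow` (stmt-NavierStokesRegularity-26567): THE PLATEAU ZOOM
# (= statement T4 `PlateauZoom` of LINE g6-β «regularised transfer», `Cruxes/NearExtremalTransiencePerFlow/Lines/regularised_transfer.lean` §1, verbatim)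

`--supports stmt-NavierStokesRegularity-28318` (helper: step (T4) of the item's plan; the same text was registered on 26567 as stub
`stub_plateauZoom` of LINE g6-β, and it is step (T4) of stub S-T `SparseSliceTransfer` of LINE g8-α `sparse_bangbang`).

THE STATEMENT (`plateauZoom`, verbatim T4).  A classical Leray–Hopf flow on `[0,T) × ℝ³` (viscosity `ν`, rapidly decaying datum, eventual
Type-I rate) which has, for every `δ > 0` and every onset, a late time `t` with a height bound `M` PINNED to the Type-I scale
(`cl√ν ≤ √(T−t)·M ≤ ch√ν`) and a FAT NEAR-TOP BALL at the parabolic scale (`vol{x ∈ B(x₀, r√(ν(T−t))) : ‖u(t,x)‖ ≥ (1−δ)M} ≥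
c₀·(r√(ν(T−t)))³`), produces the WEAK ONE-SLICE PLATEAU OBJECT of item 27822: a field `W` on `(−∞,0) × ℝ³`, jointly continuous,
Oseen-mild between all negative times, Type-I bounded, with a slice `W t₀` attaining its maximum speed `m > 0` on a set of positive volume
(which the landed `plateauSliceRigidity` excludes — not used here).

THE PROOF (moving-centre zoom; template = the landed `zoomCompact_sliceFamily` of seat ns-net-p2 with Leray's lower rate replaced by the
pinning `cl√ν ≤ √(T−t)M`).  Take `δ_n = 1/(n+2)`, onsets `T − T/(n+2)`, and the times/heights/centres `(t_n, M_n, x_n)` of the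
hypothesis.  Zoom with unit viscosity, amplitude `M_n⁻¹`, space scale `ν/M_n`, centre `x_n` and vertex `τ_n = t_n + ν(cl²/2)/M_n²` (`< T` by
the pinning), so that the slice `u(t_n)` sits at the FIXED zoom time `s₀ = −cl²/2`.  The zooms are bounded on their pasts (`N`, from the
eventual Type-I rate and the slab bound `exists_forall_norm_le_of_tao2011`) and Type-I (`K`), and their windows grow (`τ_n M_n²/ν → ∞`), so
the landed `zoomCompactnessKNSS` (KNSS 2009 Lemma 6.1) gives a weak-class limit `W` with slice-wise locally uniform convergence.  At `s₀`
the zoomed slices have height bound `1` and (landed `volume_zoom_nearPlateau_ge`) near-top sets `{‖·‖ ≥ 1 − δ_n}` of volume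
`≥ c₀ r³ ((T−t_n)M_n²/ν)^{3/2} ≥ c₀ (r·cl)³` inside the fixed ball `B(0, r·ch)`; the landed `plateauPersistenceSlice` then gives
`‖W s₀‖ ≤ 1` and `vol{‖W s₀‖ = 1} > 0`.
HONEST FRAMING: a compactness/transfer statement about hypothetical flows; nothing about Navier–Stokes regularity or blow-up is proved; no
summit is proved by a line.  Author: prover seat `ns-net-p1` (g2). [cite: KochNadirashviliSereginSverak2009, Lemma 6.1 (arXiv:0709.3599 p. 11)]
-/

noncomputable section

open scoped Topology
open Filter Set MeasureTheory Function Metric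
open Literature.Analysis Literature.Analysis.FluidPDE

namespace Summit.NavierStokesRegularity.NavierStokesRegularity.Theorems.ExtremiserTransience

-- the problem directory repeats the summit name (`NavierStokesRegularity/NavierStokesRegularity`)
set_option linter.dupNamespace false

/-- **The plateau zoom (T4 `PlateauZoom` of LINE g6-β, verbatim).**  Pinned heights and fat near-top balls at the parabolic scale along
late times of a classical Leray–Hopf Type-I flow give the weak one-slice plateau object of item 27822 (continuity on `(−∞,0) × ℝ³`,
Oseen identity, Type-I bound, and a slice with an exact positive-volume speed plateau).
[cite: KochNadirashviliSereginSverak2009, Lemma 6.1 (arXiv:0709.3599 p. 11)] -/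
theorem plateauZoom : ∀ (C ν T : ℝ), 0 < C → 0 < ν → 0 < T → ∀ (u : ℝ → EuclideanSpace ℝ (Fin 3) → EuclideanSpace ℝ (Fin 3)) (p : ℝ → EuclideanSpace ℝ (Fin 3) → ℝ), Literature.Analysis.FluidPDE.IsClassicalNSSolutionOn (Set.Ico 0 T) ν 0 u p → Literature.Analysis.FluidPDE.IsLerayHopfOn T ν 0 (u 0) u → Literature.Analysis.FluidPDE.HasRapidSpatialDecay (u 0) → (∀ᶠ t in 𝓝[<] T, ∀ x, Real.sqrt (T - t) * ‖u t x‖ ≤ C * Real.sqrt ν) → (∃ c₀ r cl ch : ℝ, 0 < c₀ ∧ 0 < r ∧ 0 < cl ∧ cl ≤ ch ∧ ∀ δ : ℝ, 0 < δ → ∀ t₁ ∈ Set.Ico 0 T, ∃ t ∈ Set.Ico t₁ T, ∃ (M : ℝ) (x₀ : EuclideanSpace ℝ (Fin 3)), (∀ x, ‖u t x‖ ≤ M) ∧ cl * Real.sqrt ν ≤ Real.sqrt (T - t) * M ∧ Real.sqrt (T - t) * M ≤ ch * Real.sqrt ν ∧ ENNReal.ofReal (c₀ * (r * Real.sqrt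 (ν * (T - t))) ^ 3) ≤ MeasureTheory.volume {x : EuclideanSpace ℝ (Fin 3) | x ∈ Metric.ball x₀ (r * Real.sqrt (ν * (T - t))) ∧ (1 - δ) * M ≤ ‖u t x‖}) → ∃ (W : ℝ → EuclideanSpace ℝ (Fin 3) → EuclideanSpace ℝ (Fin 3)) (K t₀ m : ℝ), ContinuousOn (Function.uncurry W) (Set.Iio (0 : ℝ) ×ˢ Set.univ) ∧ (∀ s t : ℝ, s < t → t < 0 → ∀ x, W t x = Literature.Analysis.FluidPDE.heatFlow (W s) (t - s) x - Literature.Analysis.FluidPDE.oseenDuhamel 1 s W W t x) ∧ (∀ t : ℝ, t < 0 → ∀ x, Real.sqrt (-t) * ‖W t x‖ ≤ K) ∧ t₀ < 0 ∧ 0 < m ∧ (∀ y, ‖W t₀ y‖ ≤ m) ∧ 0 < MeasureTheory.volume {y : EuclideanSpace ℝ (Fin 3) | ‖W t₀ y‖ = m} := by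
  intro C ν T hC hν hT u p hsol hLH hdec hrate hplat
  obtain ⟨c₀, r, cl, ch, hc₀, hr, hcl, hclch, hP⟩ := hplat
  have hsν : 0 < Real.sqrt ν := Real.sqrt_pos.2 hν
  have hch : 0 < ch := hcl.trans_le hclch
  -- ### the data along `δ_n = 1/(n+2)` and onsets `T − T/(n+2)`
  have key : ∀ n : ℕ, ∃ t : ℝ, t ∈ Set.Ico (T - T / ((n : ℝ) + 2)) T ∧
      ∃ (M : ℝ) (x₀ : EuclideanSpace ℝ (Fin 3)), (∀ x, ‖u t x‖ ≤ M) ∧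
        cl * Real.sqrt ν ≤ Real.sqrt (T - t) * M ∧ Real.sqrt (T - t) * M ≤ ch * Real.sqrt ν ∧
        ENNReal.ofReal (c₀ * (r * Real.sqrt (ν * (T - t))) ^ 3) ≤
          volume {x : EuclideanSpace ℝ (Fin 3) | x ∈ Metric.ball x₀ (r * Real.sqrt (ν * (T - t))) ∧
            (1 - 1 / ((n : ℝ) + 2)) * M ≤ ‖u t x‖} := by
    intro n
    have hn2 : (0 : ℝ) < (n : ℝ) + 2 := by positivity
    have hδ : (0 : ℝ) < 1 / ((n : ℝ) + 2) := by positivity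
    have ht₁ : T - T / ((n : ℝ) + 2) ∈ Set.Ico 0 T := by
      refine ⟨?_, ?_⟩
      · rw [sub_nonneg, div_le_iff₀ hn2]; nlinarith
      · have : 0 < T / ((n : ℝ) + 2) := div_pos hT hn2
        linarith
    obtain ⟨t, ht, M, x₀, hM, h1, h2, h3⟩ := hP _ hδ _ ht₁
    exact ⟨t, ht, M, x₀, hM, h1, h2, h3⟩
  choose t htI M x₀ hM hlow hup hfat using key
  have ht : ∀ n, t n ∈ Set.Ico 0 T := fun n => by
    refine ⟨le_trans ?_ (htI n).1, (htI n).2⟩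
    have hn2 : (0 : ℝ) < (n : ℝ) + 2 := by positivity
    rw [sub_nonneg, div_le_iff₀ hn2]; nlinarith
  have hTt : ∀ n, 0 < T - t n := fun n => sub_pos.2 (ht n).2
  have htT : Tendsto t atTop (𝓝 T) := by
    have hlow' : Tendsto (fun n : ℕ => T - T / ((n : ℝ) + 2)) atTop (𝓝 T) := by
      have h1 : Tendsto (fun n : ℕ => T / ((n : ℝ) + 2)) atTop (𝓝 0) :=
        tendsto_const_nhds.div_atTop (tendsto_natCast_atTop_atTop.atTop_add tendsto_const_nhds)
      simpa using tendsto_const_nhds.sub h1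
    exact tendsto_of_tendsto_of_tendsto_of_le_of_le hlow' tendsto_const_nhds (fun n => (htI n).1) (fun n => (htI n).2.le)
  -- positivity of the heights and the squared pinning
  have hMpos : ∀ n, 0 < M n := fun n => by
    by_contra h
    have h1 : Real.sqrt (T - t n) * M n ≤ 0 := mul_nonpos_of_nonneg_of_nonpos (Real.sqrt_nonneg _) (not_lt.1 h)
    have h2 : 0 < cl * Real.sqrt ν := mul_pos hcl hsν
    linarith [hlow n]
  have hsq : ∀ n, ν * cl ^ 2 ≤ (T - t n) * M n ^ 2 := fun n => by
    have h := pow_le_pow_left₀ (by positivity) (hlow n) 2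
    rw [mul_pow, mul_pow, Real.sq_sqrt hν.le, Real.sq_sqrt (hTt n).le] at h
    linarith
  -- the pinned ratio `ρ n = √(T − t n)·M n/√ν ∈ [cl, ch]`
  set ρ : ℕ → ℝ := fun n => Real.sqrt (T - t n) * M n / Real.sqrt ν with hρdef
  have hρl : ∀ n, cl ≤ ρ n := fun n => by
    show cl ≤ Real.sqrt (T - t n) * M n / Real.sqrt ν
    rw [le_div_iff₀ hsν]; exact hlow n
  have hρu : ∀ n, ρ n ≤ ch := fun n => by
    show Real.sqrt (T - t n) * M n / Real.sqrt ν ≤ ch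
    rw [div_le_iff₀ hsν]; exact hup n
  have hρpos : ∀ n, 0 < ρ n := fun n => hcl.trans_le (hρl n)
  -- `√ν / √(T − t n) ≤ M n / cl`
  have hratio : ∀ n, Real.sqrt ν / Real.sqrt (T - t n) ≤ M n / cl := fun n => by
    rw [div_le_div_iff₀ (Real.sqrt_pos.2 (hTt n)) hcl]
    calc Real.sqrt ν * cl = cl * Real.sqrt ν := mul_comm _ _
      _ ≤ Real.sqrt (T - t n) * M n := hlow n
      _ = M n * Real.sqrt (T - t n) := mul_comm _ _
  -- ### the eventual Type-I rate on `(t⋆, T)`; slab bound `U` on `[0, T₁]`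
  obtain ⟨tstar, htstar, hsub⟩ := mem_nhdsLT_iff_exists_Ioo_subset.1 hrate
  have htstarT : tstar < T := htstar
  set T₁ : ℝ := max ((tstar + T) / 2) (T / 2) with hT₁def
  have hT₁T : T₁ < T := max_lt (by linarith [htstarT]) (by linarith)
  have hT₁0 : 0 < T₁ := lt_of_lt_of_le (by linarith) (le_max_right _ _)
  have hT₁star : tstar < T₁ := lt_of_lt_of_le (by linarith [htstarT]) (le_max_left _ _)
  have hbdd : ∀ T₂ ∈ Ioo 0 T, ∃ M : ℝ, ∀ t ∈ Icc 0 T₂, ∀ y, ‖u t y‖ ≤ M :=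
    exists_forall_norm_le_of_tao2011 tao2011_hasBoundedSobolevNormsOn_holds hν hsol hLH hdec
  obtain ⟨U, hU⟩ := hbdd T₁ ⟨hT₁0, hT₁T⟩
  have hU0 : 0 ≤ U := (norm_nonneg _).trans (hU 0 ⟨le_rfl, hT₁0.le⟩ 0)
  have htypeI : ∀ t' : ℝ, T₁ < t' → t' < T → ∀ x, ‖u t' x‖ ≤ C * Real.sqrt ν / Real.sqrt (T - t') := by
    intro t' h1 h2 x
    have h := hsub ⟨hT₁star.trans h1, h2⟩ x
    rw [le_div_iff₀ (Real.sqrt_pos.2 (sub_pos.2 h2)), mul_comm]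
    exact h
  have hC0 : 0 ≤ C := hC.le
  -- ### the zoom data: fixed zoom time `s₀ = −cl²/2`, vertices `τ n`, centres `x₀ n`, amplitudes `M n`
  set s₀ : ℝ := -(cl ^ 2 / 2) with hs₀def
  have hs₀ : s₀ < 0 := by rw [hs₀def]; exact neg_neg_of_pos (by positivity)
  set τ : ℕ → ℝ := fun n => t n - ν * s₀ / M n ^ 2 with hτdef
  have hτt : ∀ n, τ n + ν * s₀ / M n ^ 2 = t n := fun n => by simp only [hτdef]; ring
  have hτge : ∀ n, t n < τ n := fun n => by
    have : 0 < ν * (cl ^ 2 / 2) / M n ^ 2 := by have := hMpos n; positivity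
    simp only [hτdef, hs₀def]
    rw [show ν * -(cl ^ 2 / 2) / M n ^ 2 = -(ν * (cl ^ 2 / 2) / M n ^ 2) by ring]
    linarith
  have hτpos : ∀ n, 0 < τ n := fun n => lt_of_le_of_lt (ht n).1 (hτge n)
  have hTτ : ∀ n, (T - t n) / 2 ≤ T - τ n := fun n => by
    have hM2 : 0 < M n ^ 2 := pow_pos (hMpos n) 2
    have h1 : ν * (cl ^ 2 / 2) / M n ^ 2 ≤ (T - t n) / 2 := by
      rw [div_le_iff₀ hM2]; nlinarith [hsq n]
    simp only [hτdef, hs₀def]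
    rw [show ν * -(cl ^ 2 / 2) / M n ^ 2 = -(ν * (cl ^ 2 / 2) / M n ^ 2) by ring]
    linarith
  have hτT : ∀ n, τ n < T := fun n => by linarith [hTτ n, hTt n]
  -- the uniform constants of the zooms
  set N : ℝ := max (C * Real.sqrt 2 / cl) (U * Real.sqrt T / (cl * Real.sqrt ν)) with hNdef
  have hN0 : 0 ≤ N := le_trans (by positivity) (le_max_left _ _)
  set K : ℝ := max C (U * Real.sqrt T / Real.sqrt ν) with hKdef
  have hUMb : ∀ n, U ≤ U * Real.sqrt T / (cl * Real.sqrt ν) * M n := fun n => by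
    have h1 : cl * Real.sqrt ν ≤ Real.sqrt T * M n :=
      (hlow n).trans (mul_le_mul_of_nonneg_right (Real.sqrt_le_sqrt (by linarith [(ht n).1])) (hMpos n).le)
    have h2 : 1 ≤ Real.sqrt T / (cl * Real.sqrt ν) * M n := by
      rw [div_mul_eq_mul_div, le_div_iff₀ (by positivity), one_mul]; exact h1
    calc U = U * 1 := (mul_one U).symm
      _ ≤ U * (Real.sqrt T / (cl * Real.sqrt ν) * M n) := mul_le_mul_of_nonneg_left h2 hU0
      _ = U * Real.sqrt T / (cl * Real.sqrt ν) * M n := by ring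
  have hbound : ∀ n, ∀ t' ∈ Set.Ioo 0 (τ n), ∀ z, ‖u t' z‖ ≤ N * M n := by
    intro n t' ht' z
    rcases le_or_gt t' T₁ with h1 | h1
    · calc ‖u t' z‖ ≤ U := hU t' ⟨ht'.1.le, h1⟩ z
        _ ≤ U * Real.sqrt T / (cl * Real.sqrt ν) * M n := hUMb n
        _ ≤ N * M n := mul_le_mul_of_nonneg_right (le_max_right _ _) (hMpos n).le
    · have ht'T : t' < T := ht'.2.trans (hτT n)
      have hTt' : (T - t n) / 2 ≤ T - t' := (hTτ n).trans (by linarith [ht'.2])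
      calc ‖u t' z‖ ≤ C * Real.sqrt ν / Real.sqrt (T - t') := htypeI t' h1 ht'T z
        _ ≤ C * Real.sqrt ν / Real.sqrt ((T - t n) / 2) :=
            div_le_div_of_nonneg_left (mul_nonneg hC0 hsν.le) (Real.sqrt_pos.2 (by linarith [hTt n]))
              (Real.sqrt_le_sqrt hTt')
        _ = C * Real.sqrt 2 * (Real.sqrt ν / Real.sqrt (T - t n)) := by
            rw [Real.sqrt_div' _ (by norm_num : (0 : ℝ) ≤ 2)]
            field_simp
        _ ≤ C * Real.sqrt 2 * (M n / cl) := mul_le_mul_of_nonneg_left (hratio n) (by positivity)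
        _ = C * Real.sqrt 2 / cl * M n := by ring
        _ ≤ N * M n := mul_le_mul_of_nonneg_right (le_max_left _ _) (hMpos n).le
  have hzoomI : ∀ n, ∀ s : ℝ, -(τ n * M n ^ 2 / ν) < s → s < 0 → ∀ z,
      Real.sqrt (-s) * ‖(M n)⁻¹ • u (τ n + ν * s / M n ^ 2) (x₀ n + (ν / M n) • z)‖ ≤ K := by
    intro n s hs1 hs2 z
    have hMn := hMpos n
    have hM2 : 0 < M n ^ 2 := pow_pos hMn 2
    set t' : ℝ := τ n + ν * s / M n ^ 2 with ht'def
    have ht'pos : 0 < t' := by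
      have : -(τ n) < ν * s / M n ^ 2 := by
        rw [lt_div_iff₀ hM2]
        have := mul_lt_mul_of_pos_left hs1 hν
        have e : ν * -(τ n * M n ^ 2 / ν) = -(τ n) * M n ^ 2 := by field_simp
        linarith [e ▸ this]
      simp only [ht'def]; linarith
    have ht'τ : t' < τ n := by
      have : ν * s / M n ^ 2 < 0 := div_neg_of_neg_of_pos (mul_neg_of_pos_of_neg hν hs2) hM2
      simp only [ht'def]; linarith
    have hns : 0 < -s := by linarith
    rw [norm_smul, norm_inv, Real.norm_eq_abs, abs_of_pos hMn]
    rcases le_or_gt t' T₁ with h1 | h1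
    · have hsT : -s ≤ T * M n ^ 2 / ν := by
        have e : -s = (τ n - t') * M n ^ 2 / ν := by simp only [ht'def]; field_simp; ring
        rw [e]
        gcongr
        linarith [hτT n]
      have hsqrt : Real.sqrt (-s) ≤ M n * Real.sqrt T / Real.sqrt ν := by
        calc Real.sqrt (-s) ≤ Real.sqrt (T * M n ^ 2 / ν) := Real.sqrt_le_sqrt hsT
          _ = M n * Real.sqrt T / Real.sqrt ν := by
              rw [Real.sqrt_div' _ hν.le, Real.sqrt_mul hT.le, Real.sqrt_sq hMn.le]; ring
      calc Real.sqrt (-s) * ((M n)⁻¹ * ‖u t' (x₀ n + (ν / M n) • z)‖)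
          ≤ (M n * Real.sqrt T / Real.sqrt ν) * ((M n)⁻¹ * U) := by
            gcongr
            exact hU t' ⟨ht'pos.le, h1⟩ _
        _ = U * Real.sqrt T / Real.sqrt ν := by field_simp
        _ ≤ K := le_max_right _ _
    · have ht'T : t' < T := ht'τ.trans (hτT n)
      have hTt' : ν * (-s) / M n ^ 2 ≤ T - t' := by
        have e : T - t' = (T - τ n) + ν * (-s) / M n ^ 2 := by simp only [ht'def]; ring
        rw [e]; linarith [hτT n]
      have hsqrt : Real.sqrt ν * Real.sqrt (-s) / M n ≤ Real.sqrt (T - t') := by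
        calc Real.sqrt ν * Real.sqrt (-s) / M n = Real.sqrt (ν * (-s) / M n ^ 2) := by
              rw [Real.sqrt_div' _ hM2.le, Real.sqrt_mul hν.le, Real.sqrt_sq hMn.le]
          _ ≤ Real.sqrt (T - t') := Real.sqrt_le_sqrt hTt'
      have hpos : 0 < Real.sqrt ν * Real.sqrt (-s) / M n := by positivity
      have h2 : 0 ≤ (M n)⁻¹ := by positivity
      have h3 : 0 ≤ Real.sqrt (-s) := Real.sqrt_nonneg _
      have hstep : C * Real.sqrt ν / Real.sqrt (T - t') ≤ C * Real.sqrt ν / (Real.sqrt ν * Real.sqrt (-s) / M n) :=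
        div_le_div_of_nonneg_left (mul_nonneg hC0 hsν.le) hpos hsqrt
      calc Real.sqrt (-s) * ((M n)⁻¹ * ‖u t' (x₀ n + (ν / M n) • z)‖)
          ≤ Real.sqrt (-s) * ((M n)⁻¹ * (C * Real.sqrt ν / Real.sqrt (T - t'))) :=
            mul_le_mul_of_nonneg_left (mul_le_mul_of_nonneg_left (htypeI t' h1 ht'T _) h2) h3
        _ ≤ Real.sqrt (-s) * ((M n)⁻¹ * (C * Real.sqrt ν / (Real.sqrt ν * Real.sqrt (-s) / M n))) :=
            mul_le_mul_of_nonneg_left (mul_le_mul_of_nonneg_left hstep h2) h3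
        _ = C := by field_simp
        _ ≤ K := le_max_left _ _
  -- the windows grow: `τ n (M n)² / ν → ∞`
  have hlim : Tendsto (fun n => τ n * M n ^ 2 / ν) atTop atTop := by
    have hgap : Tendsto (fun n => T - t n) atTop (𝓝[>] 0) := by
      refine tendsto_nhdsWithin_iff.2 ⟨?_, Eventually.of_forall fun n => hTt n⟩
      have h : Tendsto (fun n => T - t n) atTop (𝓝 (T - T)) := (tendsto_const_nhds (x := T)).sub htT
      rwa [sub_self] at h
    have hinv : Tendsto (fun n => (T * cl ^ 2 / 2) * (T - t n)⁻¹) atTop atTop :=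
      (tendsto_inv_nhdsGT_zero.comp hgap).const_mul_atTop (by positivity)
    refine tendsto_atTop_mono' atTop ?_ hinv
    have hev : ∀ᶠ n in atTop, T / 2 ≤ t n := by
      have : ∀ᶠ n in atTop, t n ∈ Set.Ioi (T / 2) := htT (Ioi_mem_nhds (by linarith))
      exact this.mono fun n hn => le_of_lt hn
    filter_upwards [hev] with n hn
    have hM2 : 0 < M n ^ 2 := pow_pos (hMpos n) 2
    have hgap' : 0 < T - t n := hTt n
    have hnum : (T / 2) * (ν * cl ^ 2) ≤ t n * ((T - t n) * M n ^ 2) :=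
      mul_le_mul hn (hsq n) (by positivity) (ht n).1
    calc T * cl ^ 2 / 2 * (T - t n)⁻¹ = (T / 2) * (ν * cl ^ 2) / ((T - t n) * ν) := by
          field_simp
      _ ≤ t n * ((T - t n) * M n ^ 2) / ((T - t n) * ν) :=
          div_le_div_of_nonneg_right hnum (by positivity)
      _ = t n * M n ^ 2 / ν := by field_simp
      _ ≤ τ n * M n ^ 2 / ν := by
          gcongr
          exact (hτge n).le
  -- ### KNSS compactness of the moving-centre zooms (KNSS 2009 Lemma 6.1, landed)
  obtain ⟨W, ψ, hψ, ⟨hcont, hmild, hdecW⟩, hconv⟩ :=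
    zoomCompactnessKNSS ν T u p hν hT hsol hLH hdec x₀ τ M N K hN0
      (fun n => ⟨hτpos n, hτT n, hMpos n, hbound n, hzoomI n⟩) hlim
  -- ### plateau persistence at the fixed zoom time `s₀`
  set V : ℕ → ℝ → EuclideanSpace ℝ (Fin 3) → EuclideanSpace ℝ (Fin 3) :=
    fun k s y => (M (ψ k))⁻¹ • u (τ (ψ k) + ν * s / M (ψ k) ^ 2) (x₀ (ψ k) + (ν / M (ψ k)) • y) with hVdef
  have hconvV : TendstoLocallyUniformly (fun k => V k s₀) (W s₀) atTop := hconv s₀ hs₀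
  have hVk : ∀ k, V k s₀ = fun y => (M (ψ k))⁻¹ • u (t (ψ k)) (x₀ (ψ k) + (ν / M (ψ k)) • y) := fun k => by
    funext y
    show (M (ψ k))⁻¹ • u (τ (ψ k) + ν * s₀ / M (ψ k) ^ 2) (x₀ (ψ k) + (ν / M (ψ k)) • y) = _
    rw [hτt (ψ k)]
  set η : ℝ := c₀ * (r * cl) ^ 3 with hηdef
  have hη : 0 < η := by positivity
  have hδlim : Tendsto (fun k : ℕ => (1 : ℝ) / ((ψ k : ℝ) + 2)) atTop (𝓝 0) := by
    have h1 : Tendsto (fun n : ℕ => (1 : ℝ) / ((n : ℝ) + 2)) atTop (𝓝 0) :=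
      tendsto_const_nhds.div_atTop (tendsto_natCast_atTop_atTop.atTop_add tendsto_const_nhds)
    exact h1.comp hψ.tendsto_atTop
  have hk : ∀ k, Continuous (V k s₀) ∧ (∀ y, ‖V k s₀ y‖ ≤ (fun _ : ℕ => (1 : ℝ)) k) ∧
      ENNReal.ofReal η ≤ volume {y : EuclideanSpace ℝ (Fin 3) | y ∈ Metric.ball (0 : EuclideanSpace ℝ (Fin 3)) (r * ch) ∧
        (1 - (fun k : ℕ => (1 : ℝ) / ((ψ k : ℝ) + 2)) k) * (fun _ : ℕ => (1 : ℝ)) k ≤ ‖V k s₀ y‖} := by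
    intro k
    set n : ℕ := ψ k with hndef
    have hMn := hMpos n
    rw [hVk k]
    refine ⟨?_, fun y => ?_, ?_⟩
    · -- continuity of the zoomed slice
      have hc : Continuous (u (t n)) := (hsol.contDiff_velocity (ht n)).continuous
      have haff : Continuous fun y : EuclideanSpace ℝ (Fin 3) => x₀ n + (ν / M n) • y := by fun_prop
      exact (hc.comp haff).const_smul ((M n)⁻¹)
    · -- height bound `1`
      show ‖(M n)⁻¹ • u (t n) (x₀ n + (ν / M n) • y)‖ ≤ 1
      rw [norm_smul, norm_inv, Real.norm_eq_abs, abs_of_pos hMn]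
      calc (M n)⁻¹ * ‖u (t n) (x₀ n + (ν / M n) • y)‖ ≤ (M n)⁻¹ * M n :=
            mul_le_mul_of_nonneg_left (hM n _) (inv_nonneg.2 hMn.le)
        _ = 1 := inv_mul_cancel₀ hMn.ne'
    · -- the fat near-top ball, zoomed (`volume_zoom_nearPlateau_ge`) and placed in the fixed ball `B(0, r·ch)`
      show ENNReal.ofReal η ≤ volume {y : EuclideanSpace ℝ (Fin 3) | y ∈ Metric.ball (0 : EuclideanSpace ℝ (Fin 3)) (r * ch) ∧
        (1 - 1 / ((n : ℝ) + 2)) * 1 ≤ ‖(M n)⁻¹ • u (t n) (x₀ n + (ν / M n) • y)‖}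
      have hrad : ν / M n * (r * ρ n) = r * Real.sqrt (ν * (T - t n)) := by
        show ν / M n * (r * (Real.sqrt (T - t n) * M n / Real.sqrt ν)) = r * Real.sqrt (ν * (T - t n))
        calc ν / M n * (r * (Real.sqrt (T - t n) * M n / Real.sqrt ν))
            = r * Real.sqrt (T - t n) * (ν / Real.sqrt ν) * (M n / M n) := by ring
          _ = r * Real.sqrt (T - t n) * Real.sqrt ν := by rw [div_self hMn.ne', mul_one, Real.div_sqrt]
          _ = r * Real.sqrt (ν * (T - t n)) := by rw [Real.sqrt_mul hν.le]; ring
      have hfat' := hfat n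
      rw [← hrad] at hfat'
      have hz := volume_zoom_nearPlateau_ge (u (t n)) (x₀ n) hMn hν (r * ρ n) (M n) (1 / ((n : ℝ) + 2)) hfat'
      have hscale : (M n / ν) ^ 3 * (c₀ * (ν / M n * (r * ρ n)) ^ 3) = c₀ * (r * ρ n) ^ 3 := by
        field_simp
      rw [hscale] at hz
      have hηle : η ≤ c₀ * (r * ρ n) ^ 3 := by
        rw [hηdef]
        gcongr
        exact hρl n
      calc ENNReal.ofReal η ≤ ENNReal.ofReal (c₀ * (r * ρ n) ^ 3) := ENNReal.ofReal_le_ofReal hηle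
        _ ≤ volume {y : EuclideanSpace ℝ (Fin 3) | y ∈ Metric.ball (0 : EuclideanSpace ℝ (Fin 3)) (r * ρ n) ∧
              (1 - 1 / ((n : ℝ) + 2)) * (M n / M n) ≤ ‖(M n)⁻¹ • u (t n) (x₀ n + (ν / M n) • y)‖} := hz
        _ ≤ volume {y : EuclideanSpace ℝ (Fin 3) | y ∈ Metric.ball (0 : EuclideanSpace ℝ (Fin 3)) (r * ch) ∧
              (1 - 1 / ((n : ℝ) + 2)) * 1 ≤ ‖(M n)⁻¹ • u (t n) (x₀ n + (ν / M n) • y)‖} := by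
            refine measure_mono fun y hy => ⟨?_, ?_⟩
            · exact Metric.ball_subset_ball (mul_le_mul_of_nonneg_left (hρu n) hr.le) hy.1
            · have h2 := hy.2
              rw [div_self hMn.ne'] at h2
              exact h2
  have hpers := plateauPersistenceSlice V W (fun _ => (1 : ℝ)) (fun k => (1 : ℝ) / ((ψ k : ℝ) + 2)) η (r * ch) s₀ 1
    hconvV hη one_pos hk tendsto_const_nhds hδlim
  exact ⟨W, K, s₀, 1, hcont, hmild, hdecW, hs₀, one_pos, hpers.1, hpers.2⟩

end Summit.NavierStokesRegularity.NavierStokesRegularity.Theorems.ExtremiserTransience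

end
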